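import Mathlib.Analysis.SpecialFunctions.Complex.Log
import Mathlib.Algebra.MonoidAlgebra.Basic
import Mathlib.LinearAlgebra.LinearIndependent.Basic
import Mathlib.Analysis.Real.Cardinality
import HarnessLib

/-!
# Exponential polynomials `z ↦ Σ c_μ e^{z μ}` with real frequencies: evaluation and vanishing

Topic `RepresentationTheory/CompactGroups` (used for the Zariski density of the unitary points of a
self-adjoint complex algebraic group, `UnitaryPointsZariskiDense`). An *exponential polynomial with
real frequencies* is a finite sum `F(z) = Σ_μ c_μ e^{z μ}` (`μ ∈ ℝ`, `c_μ ∈ ℂ`); we encode it by the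
element `Σ_μ c_μ [μ]` of the group algebra `ℂ[ℝ] = AddMonoidAlgebra ℂ ℝ`, so that sums and products
of exponential polynomials are handled by the algebra structure, and evaluate it through the
algebra homomorphism `expPolyEval : ℂ[ℝ] →ₐ[ℂ] (ℂ → ℂ)` (`expPolyEval a z = Σ_μ a(μ) e^{z μ}`).

Main results (all proved):

* `expPolyEval_single`, `expPolyEval_apply` — evaluation formulas;
* `eq_zero_of_forall_expPolyEval_natCast_mul_eq_zero` — **uniqueness**: if `μ ↦ e^{w μ}` is
  injective on the frequencies of `a` and `Σ_μ a(μ) e^{n w μ} = 0` for every `n ∈ ℕ`, then `a = 0`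
  (Dedekind–Artin independence of the characters `n ↦ (e^{w μ})ⁿ` of `ℕ`, Mathlib
  `linearIndependent_monoidHom`);
* `eq_zero_of_forall_expPolyEval_natCast_eq_zero` — the case `w = 1` (real exponentials are
  injective): an exponential polynomial with real frequencies vanishing on `ℕ` is zero;
* `exists_injOn_exp_I_mul` — for a finite set of real frequencies there is a real `s ≠ 0` with
  `μ ↦ e^{i s μ}` injective on it (the exceptional `s` form a countable set);
* `eq_zero_of_forall_expPolyEval_I_mul_eq_zero` — an exponential polynomial with real frequencies
  vanishing on the imaginary axis is zero.

These are the two "analytic continuation" steps of the classical proof that a self-adjoint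
algebraic subgroup `M ≤ GL_N(ℂ)` is the Zariski closure of `M ∩ U(N)` (Onishchik–Vinberg,
*Lie Groups and Algebraic Groups* (1990), Ch. 5 §2, polar decomposition of a self-adjoint
algebraic group), done here by algebra instead of complex analysis. Mathlib has exponential sums
only as analytic objects (`Complex.exp`); nothing here duplicates a Mathlib declaration
(`lean search 'expPoly|exponential polynomial'`).

## References

* A. L. Onishchik, E. B. Vinberg, *Lie Groups and Algebraic Groups*, Springer (1990), Ch. 5 §2.
* E. Artin, *Galois Theory* (1944), II.E (independence of characters; Mathlib
  `linearIndependent_monoidHom`).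
-/

noncomputable section

open Complex

namespace Literature.RepresentationTheory.CompactGroups

/-- The character `μ ↦ (z ↦ e^{z μ})` of the additive group `ℝ` (written multiplicatively) with
values in the algebra of functions `ℂ → ℂ`. [folklore] -/
def expCharFun : Multiplicative ℝ →* (ℂ → ℂ) where
  toFun μ := fun z => exp (z * ((Multiplicative.toAdd μ : ℝ) : ℂ))
  map_one' := by
    funext z
    simp
  map_mul' μ ν := by
    funext z
    simp only [toAdd_mul, ofReal_add, Pi.mul_apply, mul_add, exp_add]

/-- Unfolding `expCharFun`. [folklore] -/
@[simp] theorem expCharFun_apply (μ : Multiplicative ℝ) (z : ℂ) :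
    expCharFun μ z = exp (z * ((Multiplicative.toAdd μ : ℝ) : ℂ)) := rfl

/-- **Evaluation of exponential polynomials with real frequencies**: the algebra homomorphism
`ℂ[ℝ] → (ℂ → ℂ)` sending `Σ_μ c_μ [μ]` to `z ↦ Σ_μ c_μ e^{z μ}`. [folklore] -/
def expPolyEval : AddMonoidAlgebra ℂ ℝ →ₐ[ℂ] (ℂ → ℂ) :=
  AddMonoidAlgebra.lift ℂ (ℂ → ℂ) ℝ expCharFun

/-- `expPolyEval (c [μ]) z = c e^{z μ}`. [folklore] -/
@[simp] theorem expPolyEval_single (μ : ℝ) (c : ℂ) (z : ℂ) :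
    expPolyEval (AddMonoidAlgebra.single μ c) z = c * exp (z * μ) := by
  simp [expPolyEval, AddMonoidAlgebra.lift_single]

/-- `expPolyEval a z = Σ_μ a(μ) e^{z μ}` (sum over the frequencies of `a`). [folklore] -/
theorem expPolyEval_apply (a : AddMonoidAlgebra ℂ ℝ) (z : ℂ) :
    expPolyEval a z = a.coeff.sum fun μ c => c * exp (z * μ) := by
  rw [expPolyEval, AddMonoidAlgebra.lift_apply, Finsupp.sum, Finsupp.sum, Finset.sum_apply]
  simp

/-- **Uniqueness of exponential polynomials along an arithmetic progression.** If `μ ↦ e^{w μ}` is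
injective on the frequencies of `a` and `Σ_μ a(μ) e^{n w μ} = 0` for all `n ∈ ℕ`, then `a = 0`:
the functions `n ↦ (e^{w μ})ⁿ` are distinct characters of the monoid `ℕ`, hence linearly
independent (Dedekind–Artin). [folklore] -/
theorem eq_zero_of_forall_expPolyEval_natCast_mul_eq_zero (a : AddMonoidAlgebra ℂ ℝ) (w : ℂ)
    (hinj : Set.InjOn (fun μ : ℝ => exp (w * μ)) a.coeff.support)
    (h : ∀ n : ℕ, expPolyEval a (n * w) = 0) : a = 0 := by
  classical
  -- the characters `χ_μ : n ↦ (e^{w μ})ⁿ` of `ℕ`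
  let χ : ℝ → (Multiplicative ℕ →* ℂ) := fun μ =>
    { toFun := fun n => exp (w * μ) ^ (Multiplicative.toAdd n)
      map_one' := by simp
      map_mul' := fun m n => by simp [pow_add] }
  have hχ : ∀ μ (n : ℕ), χ μ (Multiplicative.ofAdd n) = exp ((n : ℂ) * w * μ) := by
    intro μ n
    simp only [χ, MonoidHom.coe_mk, OneHom.coe_mk, toAdd_ofAdd, ← exp_nat_mul]
    ring_nf
  -- they are pairwise distinct on the support
  have hχinj : Function.Injective fun μ : a.coeff.support => χ μ := by
    intro μ ν hμν
    have h1 := congrArg (fun f : Multiplicative ℕ →* ℂ => f (Multiplicative.ofAdd 1)) hμν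
    simp only [hχ, Nat.cast_one, one_mul] at h1
    exact Subtype.ext (hinj μ.2 ν.2 h1)
  -- hence linearly independent as functions on `ℕ`
  have hli := (linearIndependent_monoidHom (Multiplicative ℕ) ℂ).comp _ hχinj
  rw [Fintype.linearIndependent_iff] at hli
  -- the vanishing hypothesis is a linear relation among them
  have hrel : ∑ μ : a.coeff.support, a.coeff μ • ((fun f : Multiplicative ℕ →* ℂ =>
      (f : Multiplicative ℕ → ℂ)) ∘ fun μ : a.coeff.support => χ μ) μ = 0 := by
    funext n
    have hn := h (Multiplicative.toAdd n)
    rw [expPolyEval_apply, Finsupp.sum, ← Finset.sum_coe_sort] at hn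
    simp only [Finset.sum_apply, Pi.smul_apply, Function.comp_apply, smul_eq_mul, Pi.zero_apply]
    rw [← hn]
    refine Finset.sum_congr rfl fun μ _ => ?_
    rw [← ofAdd_toAdd n, hχ, toAdd_ofAdd]
  have hzero := hli (fun μ => a.coeff μ) hrel
  rw [← AddMonoidAlgebra.coeff_eq_zero]
  ext μ
  by_contra hμ
  exact hμ (hzero ⟨μ, Finsupp.mem_support_iff.2 hμ⟩)

/-- An exponential polynomial with real frequencies vanishing on `ℕ` is zero (real exponentials
are injective). [folklore] -/
theorem eq_zero_of_forall_expPolyEval_natCast_eq_zero (a : AddMonoidAlgebra ℂ ℝ)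
    (h : ∀ n : ℕ, expPolyEval a n = 0) : a = 0 := by
  refine eq_zero_of_forall_expPolyEval_natCast_mul_eq_zero a 1 ?_ (fun n => by simpa using h n)
  intro μ _ ν _ hμν
  have : Real.exp μ = Real.exp ν := by
    apply Complex.ofReal_injective
    simpa [Complex.ofReal_exp] using hμν
  exact Real.exp_injective this

/-- For a finite set `S` of real frequencies there is a real `s ≠ 0` such that `μ ↦ e^{i s μ}` is
injective on `S`: for `μ ≠ ν` the equation `e^{i s μ} = e^{i s ν}` forces `s (μ - ν) ∈ 2π ℤ`, a
countable set of exceptional `s`. [folklore] -/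
theorem exists_injOn_exp_I_mul (S : Finset ℝ) :
    ∃ s : ℝ, s ≠ 0 ∧ Set.InjOn (fun μ : ℝ => exp (I * s * μ)) S := by
  -- the exceptional set
  let B : Set ℝ := ⋃ μ ∈ (S : Set ℝ), ⋃ ν ∈ (S : Set ℝ), ⋃ k : ℤ,
    {s : ℝ | μ ≠ ν ∧ s * (μ - ν) = k * (2 * Real.pi)}
  have hB : B.Countable := by
    refine S.countable_toSet.biUnion fun μ _ => S.countable_toSet.biUnion fun ν _ =>
      Set.countable_iUnion fun k => ?_
    refine Set.Subsingleton.countable ?_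
    intro s hs t ht
    have hne : μ - ν ≠ 0 := sub_ne_zero.2 hs.1
    exact mul_right_cancel₀ hne (hs.2.trans ht.2.symm)
  have hB0 : (B ∪ {0}).Countable := hB.union (Set.countable_singleton 0)
  obtain ⟨s, hs⟩ : ∃ s : ℝ, s ∉ B ∪ {0} := by
    by_contra hall
    push Not at hall
    exact Cardinal.not_countable_real (hB0.mono fun s _ => hall s)
  simp only [Set.mem_union, Set.mem_singleton_iff, not_or] at hs
  refine ⟨s, hs.2, fun μ hμ ν hν hμν => ?_⟩
  by_contra hne
  obtain ⟨k, hk⟩ := Complex.exp_eq_exp_iff_exists_int.1 hμν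
  apply hs.1
  simp only [B, Set.mem_iUnion, Set.mem_setOf_eq, Finset.mem_coe]
  refine ⟨μ, hμ, ν, hν, k, hne, ?_⟩
  -- compare imaginary parts of `I s μ = I s ν + k 2π I`
  have him := congrArg Complex.im hk
  simp only [mul_im, I_re, I_im, ofReal_re, ofReal_im, zero_mul, one_mul, add_im, mul_re,
    sub_zero, zero_add, intCast_re, intCast_im, re_ofNat, im_ofNat] at him
  simp only [mul_zero, add_zero] at him
  nlinarith [him, Real.pi_pos]

/-- **An exponential polynomial with real frequencies vanishing on the imaginary axis is zero.**
[folklore] -/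
theorem eq_zero_of_forall_expPolyEval_I_mul_eq_zero (a : AddMonoidAlgebra ℂ ℝ)
    (h : ∀ σ : ℝ, expPolyEval a (I * σ) = 0) : a = 0 := by
  obtain ⟨s, -, hinj⟩ := exists_injOn_exp_I_mul a.coeff.support
  refine eq_zero_of_forall_expPolyEval_natCast_mul_eq_zero a (I * s) ?_ fun n => ?_
  · simpa [mul_assoc] using hinj
  · have := h (n * s)
    simpa [mul_comm, mul_left_comm, mul_assoc] using this

end Literature.RepresentationTheory.CompactGroups

end
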